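import Summits.CriticalPhenomena.SAWScalingLimit.Theorems.SAWLeftRightFKGFKGToTraversalBoundSlitNecklaceOutline
import HarnessLib

/-!
# Body refinement of a site set, part 3: the fine body of a `4`-connected site set is `4`-connected

Crux `SAWLeftRightFKG.FKGToTraversalBound` (stmt-CriticalPhenomena-1878), line `slit-necklace`, lead
prover-line-stmt-CriticalPhenomena-1878-c5-0; boundary-budget unit U6, sub-unit BB3 (body refinement), on top of
`…SlitNecklaceOutline` (`ODir`, `ODir.adj_add_vec`, `ODir.exists_eq_add_vec_of_adj`).

Registered stub `bb_refine_connected`: for a coarse site set `B ⊆ ℤ²` and a scale `M ≥ 2`, the FINE BODY `A`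
(the scaled sites `M • x`, `x ∈ B`, the fine sites strictly inside every body edge of `B` and strictly inside every
full unit square of `B`) is `4`-connected whenever `B` is: every fine site is joined inside `A` to a scaled site by a
straight fine walk (two for an interior site of a full square), and scaled sites of lattice-adjacent sites of `B`
are joined by the straight fine walk along the body edge; concatenate along a `B`-walk.

All statements folklore; no literature fact; nothing restates the crux.
-/

noncomputable section

open Literature.Probability.LatticeModels

namespace Summit.CriticalPhenomena.SAWScalingLimit.Theorems.FKGToTraversalBound.SlitNecklace

/-- A straight lattice walk of `n` steps in direction `d`, with support inside any set containing its sites.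
[folklore] -/
theorem bbt_lineWalk (P : Site 2 → Prop) (f : Site 2) (d : ODir) :
    ∀ n : ℕ, (∀ k : ℕ, k ≤ n → P (f + (k : ℤ) • d.vec)) →
      ∃ w : (zdGraph 2).Walk f (f + (n : ℤ) • d.vec), ∀ z ∈ w.support, P z := by
  intro n
  induction n with
  | zero =>
    intro h
    refine ⟨SimpleGraph.Walk.nil.copy rfl (by simp), fun z hz => ?_⟩
    simp only [SimpleGraph.Walk.support_copy, SimpleGraph.Walk.support_nil, List.mem_singleton] at hz
    subst hz
    simpa using h 0 le_rfl
  | succ n ih =>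
    intro h
    obtain ⟨w, hw⟩ := ih fun k hk => h k (by omega)
    have hadj : (zdGraph 2).Adj (f + (n : ℤ) • d.vec) (f + (n : ℤ) • d.vec + d.vec) := ODir.adj_add_vec _ d
    have heq : f + (n : ℤ) • d.vec + d.vec = f + ((n + 1 : ℕ) : ℤ) • d.vec := by push_cast; module
    refine ⟨(w.concat hadj).copy rfl heq, fun z hz => ?_⟩
    simp only [SimpleGraph.Walk.support_copy, SimpleGraph.Walk.support_concat, List.mem_append,
      List.mem_singleton] at hz
    rcases hz with hz | rfl
    · exact hw z hz
    · rw [heq]; exact h (n + 1) le_rfl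

section Mem

variable {B A : Finset (Site 2)} {M : ℕ}
  (hA : ∀ f : Site 2, f ∈ A ↔ ((∃ x ∈ B, f = (M : ℤ) • x) ∨
    (∃ x ∈ B, ∃ d : ODir, x + d.vec ∈ B ∧ ∃ t : ℤ, 0 < t ∧ t < M ∧ f = (M : ℤ) • x + t • d.vec) ∨
    (∃ x ∈ B, x + ODir.vec 0 ∈ B ∧ x + ODir.vec 1 ∈ B ∧ x + ODir.vec 0 + ODir.vec 1 ∈ B ∧ ∃ t₁ t₂ : ℤ,
      0 < t₁ ∧ t₁ < M ∧ 0 < t₂ ∧ t₂ < M ∧ f = (M : ℤ) • x + t₁ • ODir.vec 0 + t₂ • ODir.vec 1)))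
include hA

/-- The fine walk along (an initial piece of) a body edge of `B` stays in `A`. [folklore] -/
theorem bbt_armWalk {y : Site 2} {d : ODir} (hy : y ∈ B) (hyd : y + d.vec ∈ B) (n : ℕ) (hn : n ≤ M) :
    ∃ w : (zdGraph 2).Walk ((M : ℤ) • y) ((M : ℤ) • y + (n : ℤ) • d.vec), ∀ z ∈ w.support, z ∈ A := by
  refine bbt_lineWalk (· ∈ A) ((M : ℤ) • y) d n fun k hk => ?_
  rcases Nat.eq_zero_or_pos k with rfl | hk0
  · exact (hA _).2 (Or.inl ⟨y, hy, by simp⟩)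
  rcases lt_or_eq_of_le (hk.trans hn) with hkM | rfl
  · exact (hA _).2 (Or.inr (Or.inl ⟨y, hy, d, hyd, k, by exact_mod_cast hk0, by exact_mod_cast hkM, rfl⟩))
  · exact (hA _).2 (Or.inl ⟨y + d.vec, hyd, by rw [smul_add]⟩)

/-- Every fine site of `A` is joined inside `A` to a scaled site `M • y`, `y ∈ B`. [folklore] -/
theorem bbt_toCoarse {a : Site 2} (ha : a ∈ A) :
    ∃ y ∈ B, ∃ w : (zdGraph 2).Walk ((M : ℤ) • y) a, ∀ z ∈ w.support, z ∈ A := by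
  rcases (hA a).1 ha with ⟨y, hy, rfl⟩ | ⟨y, hy, d, hyd, t, ht, htM, rfl⟩ |
    ⟨y, hy, hE, hN, hEN, t₁, t₂, h₁, h₁M, h₂, h₂M, rfl⟩
  · exact ⟨y, hy, SimpleGraph.Walk.nil, by simpa using ha⟩
  · obtain ⟨w, hw⟩ := bbt_armWalk hA hy hyd t.toNat (by omega)
    exact ⟨y, hy, w.copy rfl (by rw [Int.toNat_of_nonneg ht.le]), by simpa using hw⟩
  · obtain ⟨w₁, hw₁⟩ := bbt_armWalk hA hy hN t₂.toNat (by omega)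
    have key : ∀ k : ℕ, k ≤ t₁.toNat → (M : ℤ) • y + t₂ • ODir.vec 1 + (k : ℤ) • ODir.vec 0 ∈ A := by
      intro k hk
      rcases Nat.eq_zero_or_pos k with rfl | hk0
      · exact (hA _).2 (Or.inr (Or.inl ⟨y, hy, 1, hN, t₂, h₂, h₂M, by simp⟩))
      · exact (hA _).2 (Or.inr (Or.inr ⟨y, hy, hE, hN, hEN, k, t₂, by exact_mod_cast hk0, by omega, h₂, h₂M,
          by rw [add_right_comm]⟩))
    obtain ⟨w₂, hw₂⟩ := bbt_lineWalk (· ∈ A) ((M : ℤ) • y + t₂ • ODir.vec 1) 0 t₁.toNat key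
    refine ⟨y, hy, ((w₁.copy rfl ?_).append w₂).copy rfl ?_, fun z hz => ?_⟩
    · rw [Int.toNat_of_nonneg h₂.le]
    · rw [Int.toNat_of_nonneg h₁.le, add_right_comm]
    · simp only [SimpleGraph.Walk.support_copy, SimpleGraph.Walk.mem_support_append_iff] at hz
      rcases hz with hz | hz
      exacts [hw₁ z hz, hw₂ z hz]

/-- Scaled sites of `B` joined by a walk inside `B` are joined by a fine walk inside `A`. [folklore] -/
theorem bbt_coarseWalk : ∀ {y y' : Site 2} (w : (zdGraph 2).Walk y y'), (∀ z ∈ w.support, z ∈ B) →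
    ∃ w' : (zdGraph 2).Walk ((M : ℤ) • y) ((M : ℤ) • y'), ∀ z ∈ w'.support, z ∈ A := by
  intro y y' w
  induction w with
  | nil =>
    intro h
    refine ⟨SimpleGraph.Walk.nil, fun z hz => ?_⟩
    simp only [SimpleGraph.Walk.support_nil, List.mem_singleton] at hz h
    subst hz
    exact (hA _).2 (Or.inl ⟨_, h _ rfl, rfl⟩)
  | @cons u v x hadj p ih =>
    intro h
    have hu : u ∈ B := h u (SimpleGraph.Walk.start_mem_support _)
    have hp : ∀ z ∈ p.support, z ∈ B := fun z hz =>
      h z (by rw [SimpleGraph.Walk.support_cons]; exact List.mem_cons_of_mem _ hz)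
    have hv : v ∈ B := hp v (SimpleGraph.Walk.start_mem_support _)
    obtain ⟨d, rfl⟩ := ODir.exists_eq_add_vec_of_adj hadj
    obtain ⟨w₁, hw₁⟩ := bbt_armWalk hA hu hv M le_rfl
    obtain ⟨w₂, hw₂⟩ := ih hp
    refine ⟨(w₁.copy rfl (by rw [smul_add])).append w₂, fun z hz => ?_⟩
    rw [SimpleGraph.Walk.mem_support_append_iff, SimpleGraph.Walk.support_copy] at hz
    rcases hz with hz | hz
    exacts [hw₁ z hz, hw₂ z hz]

end Mem

/-- **Registered stub `bb_refine_connected`: the fine body of a `4`-connected site set is `4`-connected.**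
Join each of the two fine sites to a scaled site inside `A` (`bbt_toCoarse`), and the two scaled sites along the
scaled image of a `B`-walk (`bbt_coarseWalk`). [folklore] -/
theorem bb_refine_connected : ∀ (B A : Finset (Site 2)) (M : ℕ), 2 ≤ M → (∀ f : Site 2, f ∈ A ↔ ((∃ x ∈ B, f = (M : ℤ) • x) ∨ (∃ x ∈ B, ∃ d : ODir, x + d.vec ∈ B ∧ ∃ t : ℤ, 0 < t ∧ t < M ∧ f = (M : ℤ) • x + t • d.vec) ∨ (∃ x ∈ B, x + ODir.vec 0 ∈ B ∧ x + ODir.vec 1 ∈ B ∧ x + ODir.vec 0 + ODir.vec 1 ∈ B ∧ ∃ t₁ t₂ : ℤ, 0 < t₁ ∧ t₁ < M ∧ 0 < t₂ ∧ t₂ < M ∧ f = (M : ℤ) • x + t₁ • ODir.vec 0 + t₂ • ODir.vec 1))) → (∀ x ∈ B, ∀ x' ∈ B, ∃ w : (zdGraph 2).Walk x x', ∀ z ∈ w.support, z ∈ B) → (∀ x ∈ A, ∀ x' ∈ A, ∃ w : (zdGraph 2).Walk x x', ∀ z ∈ w.support, z ∈ A) := by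
  intro B A M _ hA hB a ha a' ha'
  obtain ⟨y, hy, w₁, hw₁⟩ := bbt_toCoarse hA ha
  obtain ⟨y', hy', w₂, hw₂⟩ := bbt_toCoarse hA ha'
  obtain ⟨wB, hwB⟩ := hB y hy y' hy'
  obtain ⟨w, hw⟩ := bbt_coarseWalk hA wB hwB
  refine ⟨(w₁.reverse.append w).append w₂, fun z hz => ?_⟩
  simp only [SimpleGraph.Walk.mem_support_append_iff, SimpleGraph.Walk.support_reverse, List.mem_reverse] at hz
  rcases hz with (hz | hz) | hz
  exacts [hw₁ z hz, hw z hz, hw₂ z hz]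

end Summit.CriticalPhenomena.SAWScalingLimit.Theorems.FKGToTraversalBound.SlitNecklace

end
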